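import Summits.Ventures.CertifiedManyBodySolver.Observables.StiffnessThermalCouplingDilutionDial
import HarnessLib

/-!
# The `β·t = 16/5` double-occupancy PLUG in the THERMAL READER's output shape

HONEST FRAMING: a one-sided CEILING chain; not a superconductivity verdict, not a `T_c` of any material, no certificate here.
Sub-crew `hubbard-thermal` (speedrun/mbsolver, lane hubbard-lower), seat `hubbard-thermal-p1` (reader theorems), for the consumer
`hubbard-tc-mod-2` (`StiffnessThermalCouplingDilutionDial.lean`, p489447: `ThermalKTDictionaryAt.le_five_sixteenths_of_floor507_of_doccWordCap`).

The thermal certificate reader (`Literature/…/HubbardTTPrimeThermalWindowCertificateSymm.lean`,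
`IsTorusLimitOfMixture.re_expect_ge_of_thermal_certificate_symm_TT'_of_sectorGibbs`) concludes, for a certificate with objective word
`Xw ∈ 𝔄_{Λ'}` and no density / energy pinning (`μ = 0`, `κ = 0`), `c − Σₖ ‖aₖ‖ ≤ Re ω_{Λ'}(Xw)` on every torus limit `ω` of the canonical
sector Gibbs states. A DOUBLE-OCCUPANCY CAP is such a certificate with `Xw := −n_{0↑} n_{0↓}` (as an element of `𝔄_{Λ'}`, `0 ∈ Λ'`):
`lo ≤ Re ω_{Λ'}(−n_{0↑}n_{0↓})`, i.e. `Re ω(n_{0↑}n_{0↓}) ≤ −lo`.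

* `re_expect_docc_singleton_le_of_le_re_expect_neg` — the bookkeeping `Re ω_{{0}}(n_{0↑}n_{0↓}) ≤ −lo` from the reader's
  `lo ≤ Re ω_{Λ'}(−n_{0↑}n_{0↓})` (isotony `ω.compatible`, `Γ(incl) n_{xσ} = n_{xσ}`).
* `ThermalKTDictionaryAt.le_five_sixteenths_of_floor507_of_torusLimit_neg_docc_ge` — THE PLUG in the reader's shape: the literal floor
  of CERTIFIED #507 + `lo ≤ Re ω_{Λ'}(−n_{0↑}n_{0↓})` on every sector-Gibbs torus limit at `β = 16/5` of `(t,t′,U,n) = (1,0,8,7/8)` with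
  `−0.1395 ≤ lo` ⇒ `Tc ≤ 5/16`. So a certificate row in the reader's conclusion shape closes «`T_KT(8,⅞,0) ≤ 0.3125·t`» in one line.

No definition, no named fact, no certificate, no claim node; every decl PROVED. WHAT THIS IS NOT: no row (no `β·t = 16/5` docc
certificate exists at write time); no `T_c`; not a claim that the Hubbard model has a Kosterlitz–Thouless transition.

References: HazraVermaRanderia2019 eqs. (2)–(4); FawziFawziScalet2024 Thm. 3.6 (the reader's row family).
-/

noncomputable section

namespace Summit.Ventures.CertifiedManyBodySolver.Observables

open Filter Topology Matrix Finset
open Literature.MathematicalPhysics.QuantumLattice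
open Literature.MathematicalPhysics.QuantumLattice.InfVolFermionState
open Literature.MathematicalPhysics.QuantumLattice.ThermodynamicLimit
open Literature.MathematicalPhysics.StatisticalMechanics
open Literature.MathematicalPhysics.StatisticalMechanics.KosterlitzThouless
open Literature.Probability.LatticeModels
open scoped ComplexConjugate ComplexOrder

/-- **Reader output ⇒ word cap.** For any infinite-volume state `ω` and region `Λ' ∋ 0`: if `lo ≤ Re ω_{Λ'}(−n_{0↑}n_{0↓})` then
`Re ω_{{0}}(n_{0↑}n_{0↓}) ≤ −lo` — isotony (`ω.compatible`) and `Γ(incl) n_{0σ} = n_{0σ}`. [cite: FawziFawziScalet2024, Thm. 3.6] -/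
theorem re_expect_docc_singleton_le_of_le_re_expect_neg (ω : InfVolFermionState 2) {Λ' : Finset (Site 2)}
    (hz : (0 : Site 2) ∈ Λ') {lo : ℝ} (h : lo ≤ (ω.expect Λ' (-(nAt 0 hz 0 * nAt 0 hz 1))).re) :
    (ω.expect ({0} : Finset (Site 2))
        (nAt 0 (Finset.mem_singleton_self 0) 0 * nAt 0 (Finset.mem_singleton_self 0) 1)).re ≤ -lo := by
  have h0 : ({0} : Finset (Site 2)) ⊆ Λ' := Finset.singleton_subset_iff.2 hz
  have hemb : fermionEmbed (PolySite.incl h0)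
      (nAt 0 (Finset.mem_singleton_self 0) 0 * nAt 0 (Finset.mem_singleton_self 0) 1 : FermionOp ({0} : Finset (Site 2))) =
      nAt 0 hz 0 * nAt 0 hz 1 := by
    rw [map_mul, fermionEmbed_numberOp, fermionEmbed_numberOp]; rfl
  rw [← ω.compatible h0, hemb]
  rw [map_neg, Complex.neg_re] at h
  linarith

namespace ThermalKTDictionaryAt

variable {ρe : ℝ → ℝ} {Tc : ℝ}

/-- **THE PLUG in the reader's output shape: «`T_KT(8,⅞,0) ≤ 0.3125·t`» from CERTIFIED #507 and ONE thermal certificate with objective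
`−n_{0↑}n_{0↓}` at `β·t = 16/5`.** Inputs: the literal floor of CERTIFIED #507 (`−1586502349478196648362421/2⁸⁰ ≤ e(1,0,2,⅞)`, the body of
the claim node `Certificates.cert_r507_bs_GU2n7o8tp0_A4pU2_uprime`); the thermal reader's conclusion `lo ≤ Re ω_{Λ'}(−n_{0↑}n_{0↓})`
(`IsTorusLimitOfMixture.re_expect_ge_of_thermal_certificate_symm_TT'_of_sectorGibbs` with `Xw := −n_{0↑}n_{0↓}`, `μ = 0`, `κ = 0`,
`lo = c − Σₖ‖aₖ‖`) on every torus limit of the canonical sector Gibbs states of `hubbardTorusTT' L 1 0 8` on `(rectN ⅞ L, S^z = 0)` at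
`β = 16/5`; and `−0.1395 ≤ lo`. Conclusion `Tc ≤ 5/16` via `le_five_sixteenths_of_floor507_of_doccWordCap` (hubbard-tc-mod-2).
Monotonicity-free. [cite: HazraVermaRanderia2019, eqs. (2)–(4)] -/
theorem le_five_sixteenths_of_floor507_of_torusLimit_neg_docc_ge (hT : ThermalKTDictionaryAt 0 8 (7 / 8) ρe Tc)
    (hfloor : (((-1586502349478196648362421/1208925819614629174706176) : ℚ) : ℝ) ≤ energyDensityTT' 1 0 2 (7 / 8))
    {Λ' : Finset (Site 2)} (hz : (0 : Site 2) ∈ Λ') {lo : ℝ}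
    (hcap : ∀ (ω : InfVolFermionState 2) (Ls : ℕ → ℕ), Tendsto Ls atTop atTop →
      ω.IsTorusLimitOfMixture (sectorGibbsCount (7 / 8)) (fun L => sectorGibbsWeightTT' (16 / 5) 1 0 8 (7 / 8) L)
        (fun L => sectorGibbsVectorTT' 1 0 8 (7 / 8) L) Ls →
      lo ≤ (ω.expect Λ' (-(nAt 0 hz 0 * nAt 0 hz 1))).re)
    (hlo : (-0.1395 : ℝ) ≤ lo) : Tc ≤ 5 / 16 :=
  hT.le_five_sixteenths_of_floor507_of_doccWordCap hfloor (dup := -lo)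
    (fun ω Ls hLs hω => re_expect_docc_singleton_le_of_le_re_expect_neg ω hz (hcap ω Ls hLs hω)) (by linarith)

end ThermalKTDictionaryAt

end Summit.Ventures.CertifiedManyBodySolver.Observables

end
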